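import Summits.Ventures.Crystal3D.Kissing125.Classification
import Summits.Ventures.Crystal3D.Bulk.GapReduction
import Summits.Ventures.Crystal3D.Bulk.LocalTwelve
import HarnessLib

/-!
# Line `TexShadow` (stmt-Ventures-19483, v6.3): the stub `stub_l12Local : L12Local` — LANDED BY NAME (computational grade)

HONEST FRAMING. Part of the venture `Summits/Ventures/Crystal3D` (cell `crystal3d-full`), route
`route-Ventures-StickyWulffConstant`, crux `TextureLiminf` (stmt-Ventures-19483).  The planner's skeleton
`HOME/cf-p1/route/lines/tex/TexShadow.lean` (v6.3, cf-p1 gen 23) lists `stub_l12Local : L12Local` — the local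
twelve-neighbour lemma (a twelve-coordinated ball all of whose contact neighbours are twelve-coordinated has a
close-packed shell) — as an explicit stub «in tree at COMPUTATIONAL grade … the stub only records which grade the
line inherits».  This file lands it BY NAME, exactly as the skeleton's docstring prescribes:
`l12Local_of_gap_of_classification hg kissingClassification_250` with `hg : KissingGap (5/2)` obtained from the
tree's `CapX2.noHole_0625` (GAP(1.25), fourteen-ball form) through `gapTupleDiam_of_noHole`, `gapTupleDiam_iff`,
`kissingGap_of_gapTuple` — verbatim the first lines of `bulkCrystallization3D_130`
(`Kissing125/Classification.lean`).

GRADE: COMPUTATIONAL — standard axioms + `Lean.ofReduceBool` through the named `native_decide` evaluations in the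
import closure of `Kissing125.Classification` (256 `KissingSearch.checkPart_eq_true_NNN` of the κ = 7/32 growth
search + 67 `CapX2.check*_W0625` interval checks), each the evaluation of a checker whose soundness is a kernel
theorem on the standard axioms.  No `native_decide` is run in THIS file.  Referee-grade alternatives (standard
axioms, conditional on named facts) remain `l12Local_of_hales` (`flyspeck_L12`, `Hales2012_kissingConfigCongruent`)
and `l12Local_of_tammes13` (`musinTarasov2012_tammes_thirteen`).

* `Summit.Ventures.Crystal3D.Theorems.kissingGap_250 : KissingGap (5/2)` — GAP(1.25) in the point-set form the
  lane theorems of G/F/T consume (`hg : KissingGap δ`); with `kissingClassification_250` it discharges, at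
  computational grade, the pair `{KissingGap δ, KissingClassification δ}` carried BY NAME by every ledger lemma of
  the wall lanes (e.g. `hcpRunEnd_two_unsaturated`, `hcpRunEnd_ledger_floor`, `coaxialWallLaw_censusFree`).
* `Summit.Ventures.Crystal3D.Cruxes.TextureLiminf.TexShadow.stub_l12Local : L12Local` — the registered stub.

WHAT THIS IS NOT: no new mathematics (two lines of glue over the K-path head); no progress on `stub_resolution`,
`stub_barlowAdhesionR`, `stub_bilayerWall`, `stub_textureBuild`; the line's composition inherits computational
grade through this stub exactly as the planner booked; F-C1 not moved.
-/

noncomputable section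

namespace Summit.Ventures.Crystal3D.Theorems

open Summit.Ventures.Crystal3D

/-- **GAP(1.25) = `KissingGap (5/2)` HOLDS** (computational grade; diameter-one reading: a saturated ball of a
unit packing has every non-touching centre at distance `≥ 5/4`).  From `CapX2.noHole_0625` via the fourteen-ball
form `GapTupleDiam 1.25`, as in `bulkCrystallization3D_130`. -/
theorem kissingGap_250 : KissingGap (5 / 2) := by
  have hdiam : GapTupleDiam 1.25 :=
    gapTupleDiam_of_noHole (h := 1.25)
      (by rw [show (1.25 : ℝ) / 2 = 0.625 by norm_num]; exact CapX2.noHole_0625)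
  have h := kissingGap_of_gapTuple ((gapTupleDiam_iff 1.25).1 hdiam)
  rw [show (2 : ℝ) * 1.25 = 5 / 2 by norm_num] at h
  exact h

end Summit.Ventures.Crystal3D.Theorems

namespace Summit.Ventures.Crystal3D.Cruxes.TextureLiminf.TexShadow

open Summit.Ventures.Crystal3D

/-- **stub `stub_l12Local` of line `TexShadow` (stmt-Ventures-19483), BY NAME**: the local twelve-neighbour
lemma `L12Local` (a twelve-coordinated ball of a finite unit packing all of whose contact neighbours are
twelve-coordinated has a close-packed — cuboctahedral or anticuboctahedral — contact shell), from GAP(1.25)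
(`kissingGap_250`) and BIMODAL(1.25) (`kissingClassification_250`) through
`l12Local_of_gap_of_classification`.  Computational grade (see the module docstring). -/
theorem stub_l12Local : L12Local :=
  l12Local_of_gap_of_classification Theorems.kissingGap_250 kissingClassification_250

end Summit.Ventures.Crystal3D.Cruxes.TextureLiminf.TexShadow

end
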